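import Mathlib
import Summits.PneNP.PneNP.Theorems.ConvexRankGatesConvexGateBlindMonoMoment

/-!
# PneNP / ConvexRankGates — `ConvexGateBlind`, line `xor-door-perfect-completeness`:
# counting Hoeffding for Rademacher sums and the PEELING lemma (prover seat 0, session 21)

Helpers toward crux item stmt-PneNP-10680 (`--supports`; open stub `stub_exactLifting`; triangle instance of
record).  They are the probabilistic core of Lemma Ψ of memo ANALYSIS11 ("a non-negative column function whose
monochromatic share beats 1/2 by a margin is rare relative to its breadth"), by pure counting over `{0,1}^t`:

* `rademacher_card_le` (registered sub-goal `rademacher_count_bound`): for `a : Fin t → ℝ` and `s ≥ 0`,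
  `#{y : Fin t → Bool | s ≤ Σ_d ±_y a_d} ≤ 2^t · exp(−s²/(2Σ_d a_d²))`
  (`Σ_y e^{λS(y)} = Π_d (e^{λa_d} + e^{−λa_d}) ≤ 2^t e^{λ²Σa²/2}` by `cosh x ≤ e^{x²/2}`, then Markov
  `card_filter_le_mul_exp` of `…MonoMoment`, `λ = s/Σa²`);
* `peel_card_le` (registered sub-goal `peel_count_bound`): if `u + v ≤ pm` pointwise, `Σ pm ≤ 1`, and no HEAVY
  coordinate (`pm_d ≥ η`) is exceptional (`max(u_d,v_d) ≤ (1/2 + c/4)pm_d`), then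
  `#{y | 1/2 + c ≤ Σ_d (y_d ? v_d : u_d)} ≤ 2^t · exp(−9c²/(8η))`
  (heavy part `≤ (1/2+c/4)pm(H)`, light part `= pm(L)/2 +` a Rademacher sum with `Σ a² ≤ η/4`, threshold `3c/4`).
Elementary; no definitions.
-/

set_option linter.dupNamespace false -- `Summit.PneNP.PneNP.…`: summit = sub-problem (D-0017)

namespace Summit.PneNP.PneNP.Theorems.XorDoor.TriLine

open scoped BigOperators
open Finset Real

noncomputable section

variable {t : ℕ}

/-! ## §1 Exponential moments of Rademacher sums -/

/-- `e^x + e^{−x} ≤ 2e^{x²/2}` (`cosh x ≤ e^{x²/2}`). -/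
lemma exp_add_exp_neg_le (x : ℝ) : exp x + exp (-x) ≤ 2 * exp (x ^ 2 / 2) := by
  have h := Real.cosh_le_exp_half_sq x
  rw [Real.cosh_eq] at h
  linarith

/-- Product formula: `Σ_y exp(λ Σ_d ±_y a_d) = Π_d (e^{λa_d} + e^{−λa_d})`. -/
lemma sum_exp_signed_eq (a : Fin t → ℝ) (lam : ℝ) :
    ∑ y : Fin t → Bool, exp (lam * ∑ d, (if y d then a d else -a d))
      = ∏ d, (exp (lam * a d) + exp (-(lam * a d))) := by
  have h1 : ∀ y : Fin t → Bool, exp (lam * ∑ d, (if y d then a d else -a d))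
      = ∏ d, exp (lam * (if y d then a d else -a d)) := by
    intro y; rw [mul_sum, exp_sum]
  simp_rw [h1]
  rw [← Fintype.prod_sum (fun d (b : Bool) => exp (lam * (if b then a d else -a d)))]
  refine prod_congr rfl fun d _ => ?_
  rw [Fintype.sum_bool]
  simp [mul_neg]

/-- Hoeffding's moment bound: `Σ_y exp(λ Σ_d ±_y a_d) ≤ 2^t exp(λ² Σ_d a_d² / 2)`. -/
lemma sum_exp_signed_le (a : Fin t → ℝ) (lam : ℝ) :
    ∑ y : Fin t → Bool, exp (lam * ∑ d, (if y d then a d else -a d))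
      ≤ 2 ^ t * exp (lam ^ 2 * (∑ d, a d ^ 2) / 2) := by
  rw [sum_exp_signed_eq]
  calc ∏ d, (exp (lam * a d) + exp (-(lam * a d))) ≤ ∏ d, (2 * exp ((lam * a d) ^ 2 / 2)) :=
        prod_le_prod (fun d _ => by positivity) (fun d _ => exp_add_exp_neg_le _)
    _ = 2 ^ t * exp (lam ^ 2 * (∑ d, a d ^ 2) / 2) := by
        rw [prod_mul_distrib, prod_const, card_univ, Fintype.card_fin, ← exp_sum]
        congr 1
        rw [mul_sum, sum_div]
        exact congrArg exp (sum_congr rfl fun d _ => by ring)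

/-- **Counting Hoeffding for Rademacher sums.** For `s ≥ 0`:
`#{y : s ≤ Σ_d ±_y a_d} ≤ 2^t exp(−s²/(2 Σ_d a_d²))`. -/
theorem rademacher_card_le (a : Fin t → ℝ) {s : ℝ} (hs : 0 ≤ s) :
    (#(univ.filter fun y : Fin t → Bool => s ≤ ∑ d, (if y d then a d else -a d)) : ℝ)
      ≤ 2 ^ t * exp (-(s ^ 2 / (2 * ∑ d, a d ^ 2))) := by
  by_cases hA : ∑ d, a d ^ 2 = 0
  · rw [hA, mul_zero, div_zero, neg_zero, exp_zero, mul_one]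
    calc (#(univ.filter fun y : Fin t → Bool => s ≤ ∑ d, (if y d then a d else -a d)) : ℝ)
        ≤ #(univ : Finset (Fin t → Bool)) := by exact_mod_cast card_le_card (filter_subset _ _)
      _ = 2 ^ t := by simp
  · have hApos : 0 < ∑ d, a d ^ 2 := lt_of_le_of_ne (sum_nonneg fun d _ => sq_nonneg (a d)) (Ne.symm hA)
    set A : ℝ := ∑ d, a d ^ 2 with hAdef
    have hlam : 0 ≤ s / A := div_nonneg hs hApos.le
    have hM := card_filter_le_mul_exp (fun y : Fin t → Bool => ∑ d, (if y d then a d else -a d)) hlam s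
    calc (#(univ.filter fun y : Fin t → Bool => s ≤ ∑ d, (if y d then a d else -a d)) : ℝ)
        ≤ exp (-(s / A * s)) * ∑ y : Fin t → Bool, exp (s / A * ∑ d, (if y d then a d else -a d)) := hM
      _ ≤ exp (-(s / A * s)) * (2 ^ t * exp ((s / A) ^ 2 * A / 2)) :=
          mul_le_mul_of_nonneg_left (sum_exp_signed_le a (s / A)) (exp_pos _).le
      _ = 2 ^ t * exp (-(s ^ 2 / (2 * A))) := by
          rw [mul_left_comm, ← exp_add]
          congr 2
          field_simp
          ring

/-- **Counting Hoeffding** (registered sub-goal `rademacher_count_bound` of stmt-PneNP-10680, explicit form). -/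
theorem rademacher_count_bound :
    ∀ (t : ℕ) (a : Fin t → ℝ) (s : ℝ), 0 ≤ s →
    ((Finset.univ.filter fun y : Fin t → Bool => s ≤ ∑ d, (if y d then a d else -a d)).card : ℝ)
      ≤ 2 ^ t * Real.exp (-(s ^ 2 / (2 * ∑ d, a d ^ 2))) :=
  fun _ a _ hs => rademacher_card_le a hs

/-! ## §2 The peeling lemma -/

/-- **PEELING LEMMA.** Let `u, v, pm : Fin t → ℝ≥0` with `u + v ≤ pm` and `Σ pm ≤ 1`; let `c, η > 0` and suppose no
heavy coordinate is exceptional: `pm_d ≥ η → max(u_d, v_d) ≤ (1/2 + c/4)pm_d`.  Then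
`#{y : 1/2 + c ≤ Σ_d (y_d ? v_d : u_d)} ≤ 2^t exp(−9c²/(8η))`. -/
theorem peel_card_le (u v pm : Fin t → ℝ) (hu : ∀ d, 0 ≤ u d) (hv : ∀ d, 0 ≤ v d)
    (huv : ∀ d, u d + v d ≤ pm d) (hpm : ∑ d, pm d ≤ 1) {c η : ℝ} (hc : 0 < c) (hη : 0 < η)
    (hexc : ∀ d, η ≤ pm d → max (u d) (v d) ≤ (1 / 2 + c / 4) * pm d) :
    (#(univ.filter fun y : Fin t → Bool => 1 / 2 + c ≤ ∑ d, (if y d then v d else u d)) : ℝ)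
      ≤ 2 ^ t * exp (-(9 * c ^ 2 / (8 * η))) := by
  -- the Rademacher coefficients of the light coordinates
  set a : Fin t → ℝ := fun d => if pm d < η then (v d - u d) / 2 else 0 with hadef
  have hpm0 : ∀ d, 0 ≤ pm d := fun d => le_trans (add_nonneg (hu d) (hv d)) (huv d)
  -- pointwise: `W_d(y) ≤ (1/2 + c/4) π_d + ±_y a_d`
  have hpt : ∀ (y : Fin t → Bool) (d : Fin t),
      (if y d then v d else u d) ≤ (1 / 2 + c / 4) * pm d + (if y d then a d else -a d) := by
    intro y d
    by_cases hL : pm d < η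
    · have ha : a d = (v d - u d) / 2 := by simp [hadef, hL]
      rw [ha]
      have := huv d
      have := hpm0 d
      split_ifs <;> nlinarith
    · have ha : a d = 0 := by simp [hadef, hL]
      rw [ha]
      have hH := hexc d (not_lt.1 hL)
      have h1 := le_max_left (u d) (v d)
      have h2 := le_max_right (u d) (v d)
      split_ifs <;> linarith
  -- hence the event forces a Rademacher deviation of `3c/4`
  have hsub : (univ.filter fun y : Fin t → Bool => 1 / 2 + c ≤ ∑ d, (if y d then v d else u d))
      ⊆ univ.filter fun y : Fin t → Bool => 3 * c / 4 ≤ ∑ d, (if y d then a d else -a d) := by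
    intro y hy
    rw [mem_filter] at hy ⊢
    refine ⟨mem_univ _, ?_⟩
    have h1 : ∑ d, (if y d then v d else u d) ≤ ∑ d, ((1 / 2 + c / 4) * pm d + (if y d then a d else -a d)) :=
      sum_le_sum fun d _ => hpt y d
    rw [sum_add_distrib, ← mul_sum] at h1
    have h2 : (1 / 2 + c / 4) * ∑ d, pm d ≤ 1 / 2 + c / 4 := by
      have : 0 ≤ 1 / 2 + c / 4 := by linarith
      nlinarith
    linarith [hy.2]
  -- the variance proxy: `Σ a_d² ≤ η/4`
  have hvar : ∑ d, a d ^ 2 ≤ η / 4 := by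
    have hpt2 : ∀ d, a d ^ 2 ≤ η / 4 * pm d := by
      intro d
      by_cases hL : pm d < η
      · have ha : a d = (v d - u d) / 2 := by simp [hadef, hL]
        rw [ha]
        have h1 : (v d - u d) ^ 2 ≤ pm d ^ 2 := by
          have := huv d; have := hu d; have := hv d
          exact sq_le_sq' (by linarith) (by linarith)
        have h2 : pm d ^ 2 ≤ η * pm d := by
          rw [sq]; exact mul_le_mul_of_nonneg_right hL.le (hpm0 d)
        nlinarith
      · have ha : a d = 0 := by simp [hadef, hL]
        rw [ha]; have := hpm0 d; nlinarith
    calc ∑ d, a d ^ 2 ≤ ∑ d, η / 4 * pm d := sum_le_sum fun d _ => hpt2 d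
      _ = η / 4 * ∑ d, pm d := by rw [mul_sum]
      _ ≤ η / 4 := by nlinarith
  -- Hoeffding
  have hs : (0 : ℝ) ≤ 3 * c / 4 := by linarith
  have hH := rademacher_card_le a hs
  by_cases hA : ∑ d, a d ^ 2 = 0
  · -- no light fluctuation at all: the event is empty
    have ha0 : ∀ d, a d = 0 := fun d =>
      pow_eq_zero_iff (n := 2) (by norm_num) |>.1
        ((sum_eq_zero_iff_of_nonneg fun d _ => sq_nonneg (a d)).1 hA d (mem_univ d))
    have hempty : (univ.filter fun y : Fin t → Bool => 3 * c / 4 ≤ ∑ d, (if y d then a d else -a d)) = ∅ := by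
      refine filter_eq_empty_iff.2 fun y _ => ?_
      simp only [ha0, neg_zero, ite_self, sum_const_zero, not_le]
      linarith
    have h0 : (#(univ.filter fun y : Fin t → Bool => 1 / 2 + c ≤ ∑ d, (if y d then v d else u d)) : ℝ) ≤ 0 := by
      have := card_le_card hsub
      rw [hempty, card_empty] at this
      exact_mod_cast this
    exact h0.trans (by positivity)
  · have hApos : 0 < ∑ d, a d ^ 2 := lt_of_le_of_ne (sum_nonneg fun d _ => sq_nonneg (a d)) (Ne.symm hA)
    calc (#(univ.filter fun y : Fin t → Bool => 1 / 2 + c ≤ ∑ d, (if y d then v d else u d)) : ℝ)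
        ≤ #(univ.filter fun y : Fin t → Bool => 3 * c / 4 ≤ ∑ d, (if y d then a d else -a d)) := by
          exact_mod_cast card_le_card hsub
      _ ≤ 2 ^ t * exp (-((3 * c / 4) ^ 2 / (2 * ∑ d, a d ^ 2))) := hH
      _ ≤ 2 ^ t * exp (-(9 * c ^ 2 / (8 * η))) := by
          apply mul_le_mul_of_nonneg_left _ (by positivity)
          -- `(3c/4)²/(2A) ≥ 9c²/(8η)` since `A ≤ η/4`
          rw [exp_le_exp, neg_le_neg_iff, div_le_div_iff₀ (by positivity) (by positivity)]
          have h18 := mul_le_mul_of_nonneg_left hvar (by positivity : (0 : ℝ) ≤ 18 * c ^ 2)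
          calc 9 * c ^ 2 * (2 * ∑ d, a d ^ 2) = 18 * c ^ 2 * ∑ d, a d ^ 2 := by ring
            _ ≤ 18 * c ^ 2 * (η / 4) := h18
            _ = (3 * c / 4) ^ 2 * (8 * η) := by ring

/-- **Peeling lemma** (registered sub-goal `peel_count_bound` of stmt-PneNP-10680, explicit form). -/
theorem peel_count_bound :
    ∀ (t : ℕ) (u v pm : Fin t → ℝ), (∀ d, 0 ≤ u d) → (∀ d, 0 ≤ v d) → (∀ d, u d + v d ≤ pm d) →
    ∑ d, pm d ≤ 1 → ∀ (c η : ℝ), 0 < c → 0 < η →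
    (∀ d, η ≤ pm d → max (u d) (v d) ≤ (1 / 2 + c / 4) * pm d) →
    ((Finset.univ.filter fun y : Fin t → Bool => 1 / 2 + c ≤ ∑ d, (if y d then v d else u d)).card : ℝ)
      ≤ 2 ^ t * Real.exp (-(9 * c ^ 2 / (8 * η))) :=
  fun _ u v pm hu hv huv hpm _ _ hc hη hexc => peel_card_le u v pm hu hv huv hpm hc hη hexc

end

end Summit.PneNP.PneNP.Theorems.XorDoor.TriLine
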